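import Summits.Ventures.LatticeQCDFlow.Scoring.UNHaarTraceMomentsTableaux
import HarnessLib

/-!
# The `U(N)` plaquette at strong coupling is linear through order `2N`: `|P_N(β) − β/(2N)| ≤ (β/2N)·(β²/4)^N e^{β²/4}(1 + β²/(4(N+1)))/N!`

HONEST FRAMING: exact (Metropolis-corrected) sampling algorithms for lattice gauge theory;
figures of merit are autocorrelation/cost numbers at stated couplings and volumes; no
continuum-physics claim.

Venture `LatticeQCDFlow` (cell pub-lqcd), sub-topic `Scoring`; FANOUT row 5 (`s0-sun-a`), GEN-23.
NEW WORK of the cell (placement rule).  The one-plaquette (= two-dimensional, infinite-volume: GEN-19) `U(N)`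
plaquette is `P_N(β) = N⁻¹ (log Z_N)'(β)`, `Z_N(β) = det[I_{|i−j|}(β)]_{N×N}` (`OnePlaquetteHaarMGF`,
`unitary_plaquette_eq_deriv_log_det`).  From the Gaussian moments of `Re tr U` through order `2N + 1`
(`UNHaarTraceMomentsTableaux`) and the moment series of `Z_N'` (`UNTraceMomentsCentralPhase`):

* `deriv_exp_sub_deriv_det_mem_Icc`: for `β ≥ 0`,
  **`0 ≤ (β/2) e^{β²/4} − Z_N'(β) ≤ (β/2)(β²/4)^N e^{β²/4}/N!`** (the derivative of the Gaussian sandwich);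
* `abs_deriv_log_det_sub_half_le`: for `β ≥ 0`,
  **`|(log Z_N)'(β) − β/2| ≤ (β/2)·(β²/4)^N·(1 + β²/(4(N+1)))·e^{β²/4}/N!`**, i.e. the `U(N)` plaquette
  `P_N(β) = N⁻¹(log Z_N)'(β)` equals its `N = ∞` strong-coupling (Gross–Witten) value `β/(2N)` up to
  `O(β^{2N+1})`: `P_N(β) = β/(2N) + O(β^{2N+1})` as `β → 0` — for `U(N)` the strong-coupling series of the
  plaquette has no term between `β` and `β^{2N+1}`.

No `def`, no named fact, 0 sorry.
-/

noncomputable section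

open Real MeasureTheory Finset Complex ProbabilityTheory
open Literature.MathematicalPhysics.QuantumFieldTheory (haarProbability)
open Literature.Analysis.FunctionSpaces

namespace Summit.Ventures.LatticeQCDFlow.Scoring

variable {N : ℕ}

/-- **THE DERIVATIVE OF THE GAUSSIAN SANDWICH**: for `x ≥ 0`,
`0 ≤ (x/2)e^{x²/4} − Z_N'(x) ≤ (x/2)(x²/4)^N e^{x²/4}/N!`, `Z_N'(x) = ∫_{U(N)} Re tr U e^{x Re tr U} dU`. -/
theorem deriv_exp_sub_deriv_det_mem_Icc (N : ℕ) {x : ℝ} (hx : 0 ≤ x) :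
    x / 2 * Real.exp (x ^ 2 / 4) -
        ∫ U, ((U : Matrix (Fin N) (Fin N) ℂ)).trace.re * Real.exp (x * ((U : Matrix (Fin N) (Fin N) ℂ)).trace.re)
          ∂(haarProbability (Matrix.unitaryGroup (Fin N) ℂ))
      ∈ Set.Icc 0 (x / 2 * ((x ^ 2 / 4) ^ N / N.factorial) * Real.exp (x ^ 2 / 4)) := by
  have hZ := hasSum_integral_re_trace_pow_succ N x
  set a : ℕ → ℝ := fun k => x ^ k / k.factorial *
    ∫ U, ((U : Matrix (Fin N) (Fin N) ℂ)).trace.re ^ (k + 1) ∂(haarProbability (Matrix.unitaryGroup (Fin N) ℂ)) with ha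
  -- the Gaussian derivative series `(x/2) e^{x²/4} = Σ_k x^k e_{k+1}/k!`, spread over all indices (zero at the even ones)
  set b : ℕ → ℝ := fun k => if Even k then 0 else x / 2 * ((x ^ 2 / 4) ^ (k / 2) / (k / 2).factorial) with hb
  have hb0 : ∀ j, b (2 * j) = 0 := fun j => by rw [hb]; dsimp only; rw [if_pos (even_two_mul j)]
  have hb1 : ∀ j, b (2 * j + 1) = x / 2 * ((x ^ 2 / 4) ^ j / j.factorial) := fun j => by
    rw [hb]; dsimp only
    rw [if_neg (Nat.not_even_iff_odd.mpr (odd_two_mul_add_one j)),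
      show (2 * j + 1) / 2 = j by omega]
  have hE : HasSum b (x / 2 * Real.exp (x ^ 2 / 4)) := by
    have h := (NormedSpace.expSeries_div_hasSum_exp (x ^ 2 / 4)).mul_left (x / 2)
    rw [← Real.exp_eq_exp_ℝ] at h
    have h1 : HasSum (fun k : ℕ => b (2 * k + 1)) (x / 2 * Real.exp (x ^ 2 / 4)) := by
      rw [show (fun k : ℕ => b (2 * k + 1)) = fun n : ℕ => x / 2 * ((x ^ 2 / 4) ^ n / n.factorial) from funext hb1]
      exact h
    have h0 : HasSum (fun k : ℕ => b (2 * k)) 0 := by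
      rw [show (fun k : ℕ => b (2 * k)) = fun _ => 0 from funext hb0]; exact hasSum_zero
    simpa using h0.even_add_odd h1
  -- termwise: `a_k = b_k` for `k ≤ 2N`, `0 ≤ a_k ≤ b_k` always
  have ha_odd : ∀ j, a (2 * j) = 0 := fun j => by
    rw [ha]; dsimp only; rw [integral_re_trace_pow_odd, mul_zero]
  have ha_even : ∀ j, a (2 * j + 1) = x ^ (2 * j + 1) / ((2 * j + 1).factorial : ℝ) *
      ∫ U, ((U : Matrix (Fin N) (Fin N) ℂ)).trace.re ^ (2 * (j + 1)) ∂(haarProbability (Matrix.unitaryGroup (Fin N) ℂ)) :=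
    fun j => by rw [ha]; dsimp only; rw [show 2 * j + 1 + 1 = 2 * (j + 1) by ring]
  have hgauss : ∀ j, x ^ (2 * j + 1) / ((2 * j + 1).factorial : ℝ) * (((2 * (j + 1)).factorial : ℝ) /
      (4 ^ (j + 1) * (j + 1).factorial)) = x / 2 * ((x ^ 2 / 4) ^ j / j.factorial) := by
    intro j
    have h1 : ((2 * j + 1).factorial : ℝ) ≠ 0 := by positivity
    have h2 : ((j + 1).factorial : ℝ) ≠ 0 := by positivity
    rw [show 2 * (j + 1) = (2 * j + 1) + 1 by ring, Nat.factorial_succ (2 * j + 1), Nat.factorial_succ j, div_pow,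
      pow_succ, pow_succ, pow_mul]
    push_cast
    field_simp
    ring
  have hab_eq : ∀ k, k < 2 * N + 1 → a k = b k := by
    intro k hk
    rcases Nat.even_or_odd k with ⟨m, rfl⟩ | ⟨m, rfl⟩
    · rw [← two_mul, ha_odd, hb0]
    · rw [ha_even, hb1, integral_re_trace_pow_even_eq (show m + 1 ≤ N by omega), hgauss]
  have ha0 : ∀ k, 0 ≤ a k := by
    intro k
    rcases Nat.even_or_odd k with ⟨m, rfl⟩ | ⟨m, rfl⟩
    · rw [← two_mul, ha_odd]
    · rw [ha_even]
      exact mul_nonneg (div_nonneg (pow_nonneg hx _) (Nat.cast_nonneg _))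
        (integral_nonneg fun U => by rw [pow_mul]; positivity)
  have hab_le : ∀ k, a k ≤ b k := by
    intro k
    rcases Nat.even_or_odd k with ⟨m, rfl⟩ | ⟨m, rfl⟩
    · rw [← two_mul, ha_odd, hb0]
    · rw [ha_even, hb1, ← hgauss]
      exact mul_le_mul_of_nonneg_left (integral_re_trace_pow_even_le N (m + 1))
        (div_nonneg (pow_nonneg hx _) (Nat.cast_nonneg _))
  have htail : ∀ i, b (i + 2 * N) ≤ (x ^ 2 / 4) ^ N / N.factorial * b i := by
    intro i
    rcases Nat.even_or_odd i with ⟨m, rfl⟩ | ⟨m, rfl⟩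
    · rw [← two_mul, show 2 * m + 2 * N = 2 * (m + N) by ring, hb0, hb0, mul_zero]
    · rw [show 2 * m + 1 + 2 * N = 2 * (m + N) + 1 by ring, hb1, hb1, pow_add]
      have hf : ((m + N).factorial : ℝ) ≥ (m.factorial : ℝ) * N.factorial := by
        exact_mod_cast Nat.le_of_dvd (Nat.factorial_pos _) (Nat.factorial_mul_factorial_dvd_factorial_add m N)
      have hm : (0 : ℝ) < m.factorial := by positivity
      have hn : (0 : ℝ) < N.factorial := by positivity
      rw [show (x ^ 2 / 4) ^ N / ↑N.factorial * (x / 2 * ((x ^ 2 / 4) ^ m / ↑m.factorial))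
          = x / 2 * ((x ^ 2 / 4) ^ m * (x ^ 2 / 4) ^ N / (↑m.factorial * ↑N.factorial)) by field_simp]
      exact mul_le_mul_of_nonneg_left (div_le_div_of_nonneg_left (by positivity) (by positivity) hf) (by linarith)
  refine ⟨sub_nonneg.mpr (hasSum_le hab_le hZ hE), ?_⟩
  · have hd : HasSum (fun i => b (i + (2 * N + 1)) - a (i + (2 * N + 1)))
        (x / 2 * Real.exp (x ^ 2 / 4) - ∫ U, ((U : Matrix (Fin N) (Fin N) ℂ)).trace.re *
          Real.exp (x * ((U : Matrix (Fin N) (Fin N) ℂ)).trace.re) ∂(haarProbability (Matrix.unitaryGroup (Fin N) ℂ))) := by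
      have h := (hasSum_nat_add_iff' (f := fun k => b k - a k) (2 * N + 1)).mpr (hE.sub hZ)
      rwa [Finset.sum_eq_zero (fun k hk => by rw [hab_eq k (Finset.mem_range.mp hk), sub_self]), sub_zero] at h
    have ht : HasSum (fun i => (x ^ 2 / 4) ^ N / N.factorial * b (i + 1))
        ((x ^ 2 / 4) ^ N / N.factorial * (x / 2 * Real.exp (x ^ 2 / 4) - ∑ k ∈ range 1, b k)) :=
      ((hasSum_nat_add_iff' 1).mpr hE).mul_left _
    rw [Finset.sum_range_one, show b 0 = 0 from hb0 0, sub_zero] at ht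
    calc x / 2 * Real.exp (x ^ 2 / 4) - ∫ U, ((U : Matrix (Fin N) (Fin N) ℂ)).trace.re *
          Real.exp (x * ((U : Matrix (Fin N) (Fin N) ℂ)).trace.re) ∂(haarProbability (Matrix.unitaryGroup (Fin N) ℂ))
        ≤ (x ^ 2 / 4) ^ N / N.factorial * (x / 2 * Real.exp (x ^ 2 / 4)) :=
          hasSum_le (fun i => (sub_le_self _ (ha0 _)).trans (by
            rw [show i + (2 * N + 1) = (i + 1) + 2 * N by ring]; exact htail (i + 1))) hd ht
      _ = x / 2 * ((x ^ 2 / 4) ^ N / N.factorial) * Real.exp (x ^ 2 / 4) := by ring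

/-- **THE `U(N)` PLAQUETTE IS LINEAR IN THE COUPLING THROUGH ORDER `2N`**: for `β ≥ 0`,
`|(log det[I_{|i−j|}])'(β) − β/2| ≤ (β/2)·((β²/4)^N/N!)·(1 + (β²/4)/(N+1))·e^{β²/4}`; the plaquette
`P_N(β) = N⁻¹ (log det[I_{|i−j|}])'(β)` (`unitary_plaquette_eq_deriv_log_det`) is `β/(2N) + O(β^{2N+1})`. -/
theorem abs_deriv_log_det_sub_half_le (N : ℕ) {x : ℝ} (hx : 0 ≤ x) :
    |deriv (fun x : ℝ => Real.log (Matrix.of fun i j : Fin N => besselI ((i : ℤ) - (j : ℤ)).natAbs x).det) x - x / 2|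
      ≤ x / 2 * ((x ^ 2 / 4) ^ N / N.factorial) * (1 + x ^ 2 / 4 / (N + 1)) * Real.exp (x ^ 2 / 4) := by
  set Z : ℝ := (Matrix.of fun i j : Fin N => besselI ((i : ℤ) - (j : ℤ)).natAbs x).det with hZdef
  set Z' : ℝ := ∫ U, ((U : Matrix.unitaryGroup (Fin N) ℂ) : Matrix (Fin N) (Fin N) ℂ).trace.re *
    Real.exp (x * ((U : Matrix.unitaryGroup (Fin N) ℂ) : Matrix (Fin N) (Fin N) ℂ).trace.re)
      ∂(haarProbability (Matrix.unitaryGroup (Fin N) ℂ)) with hZ'def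
  have hZ1 : 1 ≤ Z := one_le_det_besselI_toeplitz N x
  have hZpos : 0 < Z := one_pos.trans_le hZ1
  have hderiv : deriv (fun x : ℝ => Real.log (Matrix.of fun i j : Fin N => besselI ((i : ℤ) - (j : ℤ)).natAbs x).det) x
      = Z' / Z := ((hasDerivAt_det_besselI_toeplitz N x).log hZpos.ne').deriv
  rw [hderiv]
  have hA := deriv_exp_sub_deriv_det_mem_Icc N hx
  have hB := exp_sub_det_besselI_toeplitz_mem_Icc N x
  rw [Set.mem_Icc] at hA hB
  -- `|Z'/Z − x/2| = |Z' − (x/2) Z| / Z ≤ |Z' − (x/2) Z|`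
  have hkey : |Z' / Z - x / 2| ≤ |Z' - x / 2 * Z| := by
    rw [show Z' / Z - x / 2 = (Z' - x / 2 * Z) / Z by field_simp, abs_div, abs_of_pos hZpos]
    exact div_le_self (abs_nonneg _) hZ1
  refine hkey.trans ?_
  -- `Z' − (x/2)Z = −((x/2)e − Z') + (x/2)(e − Z)`
  rw [show Z' - x / 2 * Z = -(x / 2 * Real.exp (x ^ 2 / 4) - Z') + x / 2 * (Real.exp (x ^ 2 / 4) - Z) by ring]
  refine (abs_add_le _ _).trans ?_
  rw [abs_neg, abs_of_nonneg hA.1, abs_of_nonneg (mul_nonneg (by linarith) hB.1)]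
  have hN1 : (0 : ℝ) < N + 1 := by positivity
  calc x / 2 * Real.exp (x ^ 2 / 4) - Z' + x / 2 * (Real.exp (x ^ 2 / 4) - Z)
      ≤ x / 2 * ((x ^ 2 / 4) ^ N / N.factorial) * Real.exp (x ^ 2 / 4)
          + x / 2 * ((x ^ 2 / 4) ^ (N + 1) / (N + 1).factorial * Real.exp (x ^ 2 / 4)) :=
        add_le_add hA.2 (mul_le_mul_of_nonneg_left hB.2 (by linarith))
    _ = x / 2 * ((x ^ 2 / 4) ^ N / N.factorial) * (1 + x ^ 2 / 4 / (N + 1)) * Real.exp (x ^ 2 / 4) := by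
        rw [Nat.factorial_succ, pow_succ]
        push_cast
        field_simp
        ring

end Summit.Ventures.LatticeQCDFlow.Scoring
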